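import Summits.QuantumFields.YangMills.Theorems.LuscherReductionRunningReductionInnerRegion
import HarnessLib

/-!
# Polyakov lines on `(ℤ/L)³` and the DISJOINTNESS of the eight inner neighbourhoods: a configuration within orbit distance `r < 2/L` of the
# pure gauges cannot also be within `r` of a non-trivial twist class (sub-stub C2e of the fixed-lattice programme COARSE(L₀) — route
# `LuscherReduction`, crux RED stmt-QuantumFields-19978 KT-door 3b′ / crux `TwistedTraceScaling` stmt-QuantumFields-20203 S-BASE; design note
# `pub/ym-fleet/ym-luscher-20007-p1/COARSE-DESIGN.md` §2, §7 (i))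

The INNER piece `cos Θ_δ · ψ` of the onion theorem (`qform_le_three_regions_lat`) lives in the union of the eight neighbourhoods
`{orbitDist (twist3 z U) < δ}`, `z : Fin 3 → Bool`.  For the Born–Oppenheimer analysis one wants them DISJOINT, so that the inner piece is a
sum of eight twist-images of ONE piece near the vacuum orbit.  The separating invariant is the Polyakov line (straight Wilson line winding once
around the torus in direction `k`):

* `lineProd U x k n` — the ordered product of the first `n` links in direction `k` from `x`; `lineProd U x k L` is the closed line;
* `lineProd_gaugeTransform` — gauge covariance (telescoping; the loop closes because `L • ê_k = 0` in `(ℤ/L)³`), hence the trace is gauge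
  invariant (`re_trace_lineProd_gaugeTransform`);
* `lineProd_twist3` — a composite twist multiplies the closed line by `centreElem (z k)`: the line crosses the plane `x_k = 0` exactly once;
* `re_trace_lineProd_ge_of_near_one` — if every link is within `r` of `1` the closed line is within `L·r` of `1`, so `Re tr ≥ 2 − (Lr)²/2`;
* ★ `twist3_trivial_of_orbitDist_lt` — if `L·r < 2`, `orbitDist U < r` and `orbitDist (twist3 z U) < r`, then `z = (fun _ => false)`: the eight
  inner neighbourhoods of radius `< 2/L` are pairwise disjoint (apply to `U' = twist3 w U`).
HONEST FRAMING: lattice combinatorics; femto rung R2b1; not a gap, not Clay.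
-/

set_option autoImplicit false

noncomputable section

open MeasureTheory Filter Topology Real
open scoped Matrix ComplexConjugate BigOperators
open Literature.MathematicalPhysics.QuantumFieldTheory
open Literature.MathematicalPhysics.QuantumLattice

namespace Summit.QuantumFields.YangMills.Theorems.FemtoTransferGap

variable {L : ℕ} [NeZero L]

/-! ## §1 Partial Polyakov lines -/

omit [NeZero L] in
/-- The site `x + n ê_k`, coordinatewise. [folklore] -/
theorem site_add_nsmul_apply (x : Site 3 L) (k : Fin 3) (n : ℕ) (j : Fin 3) :
    (x + (Pi.single k ((n : ℕ) : ZMod L) : Site 3 L)) j = x j + if j = k then ((n : ℕ) : ZMod L) else 0 := by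
  rw [Pi.add_apply, Pi.single_apply]

omit [NeZero L] in
/-- `(x + n ê_k).shift k = x + (n+1) ê_k`. [folklore] -/
theorem shift_add_nsmul (x : Site 3 L) (k : Fin 3) (n : ℕ) :
    Site.shift (x + (Pi.single k ((n : ℕ) : ZMod L) : Site 3 L)) k = x + (Pi.single k (((n + 1 : ℕ) : ℕ) : ZMod L) : Site 3 L) := by
  rw [Site.shift, add_assoc, ← Pi.single_add]
  congr 2
  push_cast; ring

omit [NeZero L] in
/-- Winding once: `x + L ê_k = x` on `(ℤ/L)³`. [folklore] -/
theorem add_L_nsmul (x : Site 3 L) (k : Fin 3) : x + (Pi.single k ((L : ℕ) : ZMod L) : Site 3 L) = x := by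
  rw [ZMod.natCast_self, Pi.single_zero, add_zero]

/-- **Partial Polyakov line**: `lineProd U x k n = U(x,k) U(x+ê_k,k) ⋯ U(x+(n−1)ê_k,k)`. [cite: tHooft1979] -/
def lineProd (U : GaugeConfig 3 L SU2) (x : Site 3 L) (k : Fin 3) : ℕ → SU2
  | 0 => 1
  | n + 1 => lineProd U x k n * U (x + (Pi.single k ((n : ℕ) : ZMod L) : Site 3 L), k)

omit [NeZero L] in
/-- The empty line is `1`. [folklore] -/
@[simp] theorem lineProd_zero (U : GaugeConfig 3 L SU2) (x : Site 3 L) (k : Fin 3) : lineProd U x k 0 = 1 := rfl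

omit [NeZero L] in
/-- One more link: `lineProd U x k (n+1) = lineProd U x k n · U(x + n ê_k, k)`. [folklore] -/
theorem lineProd_succ (U : GaugeConfig 3 L SU2) (x : Site 3 L) (k : Fin 3) (n : ℕ) :
    lineProd U x k (n + 1) = lineProd U x k n * U (x + (Pi.single k ((n : ℕ) : ZMod L) : Site 3 L), k) := rfl

/-! ## §2 Gauge covariance -/

omit [NeZero L] in
/-- Telescoping: `lineProd (U^g) x k n = g(x) · lineProd U x k n · g(x + n ê_k)⁻¹`. [folklore] -/
theorem lineProd_gaugeTransform (g : Site 3 L → SU2) (U : GaugeConfig 3 L SU2) (x : Site 3 L) (k : Fin 3) (n : ℕ) :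
    lineProd (gaugeTransform g U) x k n = g x * lineProd U x k n * (g (x + (Pi.single k ((n : ℕ) : ZMod L) : Site 3 L)))⁻¹ := by
  induction n with
  | zero => simp [lineProd]
  | succ n ih =>
    rw [lineProd_succ, lineProd_succ, ih]
    simp only [gaugeTransform, shift_add_nsmul]
    group

omit [NeZero L] in
/-- The closed Polyakov line is gauge COVARIANT: `P_k(U^g; x) = g(x) P_k(U; x) g(x)⁻¹`. [cite: tHooft1979] -/
theorem lineProd_gaugeTransform_closed (g : Site 3 L → SU2) (U : GaugeConfig 3 L SU2) (x : Site 3 L) (k : Fin 3) :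
    lineProd (gaugeTransform g U) x k L = g x * lineProd U x k L * (g x)⁻¹ := by
  rw [lineProd_gaugeTransform, add_L_nsmul]

omit [NeZero L] in
/-- Hence its trace is gauge INVARIANT. [cite: tHooft1979] -/
theorem re_trace_lineProd_gaugeTransform (g : Site 3 L → SU2) (U : GaugeConfig 3 L SU2) (x : Site 3 L) (k : Fin 3) :
    (((lineProd (gaugeTransform g U) x k L : SU2) : Matrix (Fin 2) (Fin 2) ℂ).trace).re =
      (((lineProd U x k L : SU2) : Matrix (Fin 2) (Fin 2) ℂ).trace).re := by
  rw [lineProd_gaugeTransform_closed, Submonoid.coe_mul, Submonoid.coe_mul, Matrix.trace_mul_cycle, ← Submonoid.coe_mul,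
    inv_mul_cancel, OneMemClass.coe_one, Matrix.one_mul]

/-! ## §3 The twist flips the line exactly once -/

/-- The number of crossings of the plane `x_k = 0` among the first `n` links of the line. [folklore] -/
def crossCount (x : Site 3 L) (k : Fin 3) (n : ℕ) : ℕ :=
  ∑ t ∈ Finset.range n, if x k + ((t : ℕ) : ZMod L) = 0 then 1 else 0

omit [NeZero L] in
/-- The partial line of a twisted configuration: the central factors collected in front as a power. [folklore] -/
theorem lineProd_twist3 (z : Fin 3 → Bool) (U : GaugeConfig 3 L SU2) (x : Site 3 L) (k : Fin 3) (n : ℕ) :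
    lineProd (TT.twist3 z U) x k n = TT.centreElem (z k) ^ crossCount x k n * lineProd U x k n := by
  induction n with
  | zero => simp [lineProd, crossCount]
  | succ n ih =>
    rw [lineProd_succ, lineProd_succ, ih, TT.twist3_apply]
    dsimp only
    have hx : (x + (Pi.single k ((n : ℕ) : ZMod L) : Site 3 L)) k = x k + ((n : ℕ) : ZMod L) := by
      rw [site_add_nsmul_apply, if_pos rfl]
    simp only [hx]
    have hcount : crossCount x k (n + 1) = crossCount x k n + if x k + ((n : ℕ) : ZMod L) = 0 then 1 else 0 := by
      unfold crossCount; rw [Finset.sum_range_succ]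
    rw [hcount, pow_add]
    set c : SU2 := if x k + ((n : ℕ) : ZMod L) = 0 then TT.centreElem (z k) else 1 with hc
    have hcpow : TT.centreElem (z k) ^ (if x k + ((n : ℕ) : ZMod L) = 0 then 1 else 0) = c := by
      rw [hc]; split_ifs <;> simp
    rw [hcpow]
    have hcc : c ∈ Subgroup.center SU2 := by
      rw [hc]; split_ifs
      · exact TT.centreElem_mem_center _
      · exact Subgroup.one_mem _
    have hcomm := Subgroup.mem_center_iff.mp hcc
    -- `(A * P) * (c * u) = (A * c) * (P * u)` since `c` is central
    rw [← mul_assoc, mul_assoc _ (lineProd U x k n) c, hcomm (lineProd U x k n), ← mul_assoc,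
      mul_assoc _ (lineProd U x k n)]

/-- Reindexing a sum over `range L` through `t ↦ a + t` in `ZMod L`. [folklore] -/
theorem sum_range_add_cast {M : Type*} [AddCommMonoid M] (a : ZMod L) (f : ZMod L → M) :
    ∑ t ∈ Finset.range L, f (a + ((t : ℕ) : ZMod L)) = ∑ b : ZMod L, f b := by
  refine Finset.sum_nbij' (fun t => a + ((t : ℕ) : ZMod L)) (fun b => (b - a).val) ?_ ?_ ?_ ?_ ?_
  · intro t _; exact Finset.mem_univ _
  · intro b _; exact Finset.mem_range.2 (ZMod.val_lt _)
  · intro t ht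
    have ht' : t < L := Finset.mem_range.1 ht
    show (a + ((t : ℕ) : ZMod L) - a).val = t
    rw [add_sub_cancel_left, ZMod.val_natCast_of_lt ht']
  · intro b _
    show a + (((b - a).val : ℕ) : ZMod L) = b
    rw [ZMod.natCast_zmod_val, add_sub_cancel]
  · intro t _; rfl

/-- The closed line crosses the plane `x_k = 0` exactly once. [cite: tHooft1979] -/
theorem crossCount_closed (x : Site 3 L) (k : Fin 3) : crossCount x k L = 1 := by
  unfold crossCount
  rw [sum_range_add_cast (x k) (fun b => if b = 0 then (1 : ℕ) else 0)]
  rw [Finset.sum_ite_eq' Finset.univ (0 : ZMod L)]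
  simp

/-- ★ **The closed Polyakov line of a twisted configuration**: `P_k(twist3 z U) = centreElem (z k) · P_k(U)`. [cite: tHooft1979] -/
theorem lineProd_twist3_closed (z : Fin 3 → Bool) (U : GaugeConfig 3 L SU2) (x : Site 3 L) (k : Fin 3) :
    lineProd (TT.twist3 z U) x k L = TT.centreElem (z k) * lineProd U x k L := by
  rw [lineProd_twist3, crossCount_closed, pow_one]

/-- In traces: a twist with `z k = true` flips the sign of `Re tr P_k`. [cite: tHooft1979] -/
theorem re_trace_lineProd_twist3_true {z : Fin 3 → Bool} {k : Fin 3} (hz : z k = true) (U : GaugeConfig 3 L SU2) (x : Site 3 L) :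
    (((lineProd (TT.twist3 z U) x k L : SU2) : Matrix (Fin 2) (Fin 2) ℂ).trace).re =
      -(((lineProd U x k L : SU2) : Matrix (Fin 2) (Fin 2) ℂ).trace).re := by
  rw [lineProd_twist3_closed, hz]
  simp only [TT.centreElem, if_true, coe_negOne_mul, Matrix.trace_neg, Complex.neg_re]

/-! ## §4 Near the vacuum the line is near `1` -/

omit [NeZero L] in
/-- If every link is within `r` of `1`, the partial line of length `n` is within `n·r` of `1`. [folklore] -/
theorem frobNorm_lineProd_sub_one_le (U : GaugeConfig 3 L SU2) {r : ℝ}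
    (hr : ∀ e : Edge 3 L, frobNorm (((U e : SU2) : Matrix (Fin 2) (Fin 2) ℂ) - 1) ≤ r) (x : Site 3 L) (k : Fin 3) (n : ℕ) :
    frobNorm (((lineProd U x k n : SU2) : Matrix (Fin 2) (Fin 2) ℂ) - 1) ≤ n * r := by
  induction n with
  | zero => simp [lineProd, frobNorm_zero]
  | succ n ih =>
    rw [lineProd_succ]
    refine (frobNorm_mul_sub_one_le _ _).trans ?_
    push_cast
    linarith [hr (x + (Pi.single k ((n : ℕ) : ZMod L) : Site 3 L), k)]

omit [NeZero L] in
/-- Hence `Re tr P_k ≥ 2 − (L·r)²/2` for every configuration within gauge-fixed link distance `r` of the vacuum. [folklore] -/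
theorem re_trace_lineProd_ge_of_near_one (U : GaugeConfig 3 L SU2) {r : ℝ}
    (hr : ∀ e : Edge 3 L, frobNorm (((U e : SU2) : Matrix (Fin 2) (Fin 2) ℂ) - 1) ≤ r) (x : Site 3 L) (k : Fin 3) :
    2 - ((L : ℝ) * r) ^ 2 / 2 ≤ (((lineProd U x k L : SU2) : Matrix (Fin 2) (Fin 2) ℂ).trace).re := by
  have h := frobNorm_lineProd_sub_one_le U hr x k L
  have h0 : 0 ≤ frobNorm (((lineProd U x k L : SU2) : Matrix (Fin 2) (Fin 2) ℂ) - 1) := frobNorm_nonneg _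
  have hsq : frobNorm (((lineProd U x k L : SU2) : Matrix (Fin 2) (Fin 2) ℂ) - 1) ^ 2 ≤ ((L : ℝ) * r) ^ 2 :=
    pow_le_pow_left₀ h0 h 2
  have htr := two_sub_re_trace_eq (lineProd U x k L)
  linarith

/-- The same from the orbit distance: `orbitDist U < r ⇒ Re tr P_k(U) ≥ 2 − (Lr)²/2` (trace gauge invariance). [folklore] -/
theorem re_trace_lineProd_ge_of_orbitDist_lt {U : GaugeConfig 3 L SU2} {r : ℝ} (hU : orbitDist U < r) (x : Site 3 L) (k : Fin 3) :
    2 - ((L : ℝ) * r) ^ 2 / 2 ≤ (((lineProd U x k L : SU2) : Matrix (Fin 2) (Fin 2) ℂ).trace).re := by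
  obtain ⟨g, hg⟩ := exists_gauge_near_of_orbitDist_lt hU
  rw [← re_trace_lineProd_gaugeTransform g U x k]
  exact re_trace_lineProd_ge_of_near_one (gaugeTransform g U) (fun e => (hg e).le) x k

/-! ## §5 Disjointness of the eight inner neighbourhoods -/

/-- ★ **Disjointness.**  If `L·r < 2`, `orbitDist U < r` and `orbitDist (twist3 z U) < r`, then `z` is the trivial twist. [cite: tHooft1979]
[cite: Luscher1983, §2] -/
theorem twist3_trivial_of_orbitDist_lt {U : GaugeConfig 3 L SU2} {r : ℝ} (hLr : (L : ℝ) * r < 2) (hU : orbitDist U < r)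
    {z : Fin 3 → Bool} (hz : orbitDist (TT.twist3 z U) < r) : z = fun _ => false := by
  funext k
  by_contra hk
  have hzk : z k = true := by simpa using hk
  have hr0 : 0 ≤ r := (orbitDist_nonneg U).trans hU.le
  have hL0 : (0 : ℝ) ≤ (L : ℝ) := Nat.cast_nonneg L
  have hLr0 : 0 ≤ (L : ℝ) * r := mul_nonneg hL0 hr0
  have h1 := re_trace_lineProd_ge_of_orbitDist_lt hU (0 : Site 3 L) k
  have h2 := re_trace_lineProd_ge_of_orbitDist_lt hz (0 : Site 3 L) k
  rw [re_trace_lineProd_twist3_true hzk] at h2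
  -- `2 − (Lr)²/2 ≤ T` and `2 − (Lr)²/2 ≤ −T` force `(Lr)² ≥ 4`, contradicting `Lr < 2`
  nlinarith

/-- The eight inner neighbourhoods of radius `r < 2/L` are pairwise disjoint: `orbitDist (twist3 w U) < r` and `orbitDist (twist3 z U) < r`
imply `w = z`. [cite: tHooft1979] -/
theorem twist3_eq_of_orbitDist_lt {U : GaugeConfig 3 L SU2} {r : ℝ} (hLr : (L : ℝ) * r < 2) {w z : Fin 3 → Bool}
    (hw : orbitDist (TT.twist3 w U) < r) (hz : orbitDist (TT.twist3 z U) < r) : w = z := by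
  have hz' : orbitDist (TT.twist3 (fun k => Bool.xor (z k) (w k)) (TT.twist3 w U)) < r := by
    rw [TT.twist3_twist3]
    have : (fun k => Bool.xor (Bool.xor (z k) (w k)) (w k)) = z := by funext k; simp
    rw [this]; exact hz
  have h := twist3_trivial_of_orbitDist_lt hLr hw hz'
  funext k
  have hk : Bool.xor (z k) (w k) = false := congr_fun h k
  revert hk
  cases z k <;> cases w k <;> decide

end Summit.QuantumFields.YangMills.Theorems.FemtoTransferGap

end
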